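import Summits.BirchSwinnertonDyer.BirchSwinnertonDyer.Theorems.ClassRecordThreeCartanOnePlaceDegreeLawAtThreeCMRankPrintInputsThree
import Summits.BirchSwinnertonDyer.BirchSwinnertonDyer.Theorems.ClassRecordThreeEulerHalvesAtThreeCartanCoverInertHecke
import Summits.BirchSwinnertonDyer.BirchSwinnertonDyer.Theorems.ClassRecordThreeEulerHalvesAtThreeCartanCoverPeriodLattice
import Summits.BirchSwinnertonDyer.BirchSwinnertonDyer.Theorems.ClassRecordThreeEulerHalvesAtThreeCartanCoverStrongApprox
import Literature.NumberTheory.Automorphic.QuaternionOrderResidueStrongApproximation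
import HarnessLib

/-!
# Sketch (stub-critic): the Summit-side DICTIONARY for plan P0 of `STUB-PLAN-stub_jacquetVectorResidual.md` — SIGNATURES ONLY (`sorry`).

(JVᴸ) `cartanCover_unipotentFixed_in_span` (the candidate Literature named fact, copied from `Sketch-scrit.lean`) ⟹ (JV_Q) `JacquetVectorDocked`
(verbatim copy, primed) through two tree-provable lemmas: D-EV (the value-at-`1` map sends `ℂ[G]·u_C` ONTO the `ℂ`-span of the slashes `F₀ ∣[2] γ`,
`γ ∈ Γ'`; strong approximation `redHom_surjective_of_odd`) and D-AVG (unipotent averaging).  The Lines module is not built on the farm, hence the copies.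
-/

noncomputable section

open scoped Classical MatrixGroups NumberField ModularForm
open Matrix IsDedekindDomain NumberField WeierstrassCurve
open Literature.NumberTheory.Automorphic Literature.NumberTheory.EllipticCurves
open Summit.BirchSwinnertonDyer.BirchSwinnertonDyer.Theorems
open Summit.BirchSwinnertonDyer.BirchSwinnertonDyer.Theorems.CartanCover
open Summit.BirchSwinnertonDyer.BirchSwinnertonDyer.Theorems.CartanCover.Charext.InertHecke (upperUnip)
open Summit.BirchSwinnertonDyer.BirchSwinnertonDyer.Theorems.CartanCover.CMRank
open Literature.NumberTheory.EllipticCurves.Rank1Residual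

namespace ScritSketchDict

/-- Copy of the candidate Literature fact (JVᴸ) of `Sketch-scrit.lean` (identical text). -/
def cartanCover_unipotentFixed_in_span : Prop :=
  ∀ (D M : ℕ) (C : Finset ℕ) (X : CartanLevelCurveData D M C) (q : ℕ) [Fact q.Prime], q ∈ C → q % 3 = 1 →
    ∀ (hO' : Brandt.IsOrder X.B (X.O ⊔ X.O₀.map ((((∏ p ∈ C.erase q, p : ℕ) : ℤ)) • LinearMap.id)))
      (S : Subring X.B) (_hS : ∀ x : X.B, x ∈ S ↔ x ∈ X.O ⊔ X.O₀.map ((((∏ p ∈ C.erase q, p : ℕ) : ℤ)) • LinearMap.id))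
      (red : S →+* Matrix (Fin 2) (Fin 2) (ZMod q)),
      Function.Surjective red →
      (∀ x : S, red x = 0 ↔ ∃ y ∈ X.O ⊔ X.O₀.map ((((∏ p ∈ C.erase q, p : ℕ) : ℤ)) • LinearMap.id), (x : X.B) = (q : ℤ) • y) →
      (∀ x : S, ∃ n : ℤ, reducedNorm ℚ X.B (x : X.B) = n ∧ (red x).det = (n : ZMod q)) →
    ∀ (V : WeierstrassCurve ℚ) [V.IsElliptic] [V.IsGloballyMinimal] (N : ℕ),
      V.conductorNorm ℤ = N → D * M * ∏ p ∈ C, p ^ 2 = N → ¬ q ^ 3 ∣ N →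
      3 ∣ (V.baseChange ℚ_[q]).localTamagawaNumber ℤ_[q] →
    ∀ F₀ : CuspForm X.Gamma 2, (⇑F₀ : UpperHalfPlane → ℂ) ≠ 0 →
      (∀ ℓ : ℕ, ℓ.Prime → ¬ ℓ ∣ D * M * ∏ p ∈ C, p →
        X.heckeFun ℓ F₀ = fun τ => ((V.LFunction ℓ : ℤ) : ℂ) * F₀ τ) →
      ∃ G ∈ Submodule.span ℂ (Set.range fun γ : normOneUnits X.ι hO' =>
          (⇑F₀ : UpperHalfPlane → ℂ) ∣[(2 : ℤ)] ((γ : GL (Fin 2) ℝ))),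
        G ≠ 0 ∧ ∀ (γ : normOneUnits X.ι hO') (x : S), X.ι (x : X.B) = ((γ : GL (Fin 2) ℝ) : Matrix (Fin 2) (Fin 2) ℝ) →
          (red x) 0 0 = 1 → (red x) 1 0 = 0 → (red x) 1 1 = 1 →
          G ∣[(2 : ℤ)] ((γ : GL (Fin 2) ℝ)) = G

/-- VERBATIM copy of `Jacquet.JacquetVectorDocked` (jacquet.lean l.1310). -/
def JacquetVectorDocked' : Prop :=
  ∀ (V : WeierstrassCurve ℚ) [V.IsElliptic] [V.IsGloballyMinimal], Surj V 3 →
    ∀ (N D M : ℕ) (C : Finset ℕ) (q : ℕ) [Fact q.Prime]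
      (X : CartanLevelCurveData D M C) (W₁ : WeierstrassCurve ℚ) [W₁.IsElliptic] (Q : CartanParametrizationData X W₁)
      (hq : q ∈ C) (R : CoverReduction X q),
      V.conductorNorm ℤ = N → D * M * ∏ p ∈ C, p ^ 2 = N → q ≠ 3 → ¬ q ^ 3 ∣ N →
      3 ∣ (V.baseChange ℚ_[q]).localTamagawaNumber ℤ_[q] → Q.IsMinimalFor V → q % 3 = 1 →
      ∃ x ∈ R.spanG (R.dockNonsplit hq Q.form), x ≠ 0 ∧ ∀ y : ZMod q, R.indRep (upperUnip y) x = x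

variable {D M : ℕ} {C : Finset ℕ} {X : CartanLevelCurveData D M C} {q : ℕ} [Fact q.Prime]

/-- The value-at-`1` map `x ↦ ⇑(x 1) : IndCuspForm → (ℍ → ℂ)` (ℂ-linear). -/
def coeEvOne (R : CoverReduction X q) : R.IndCuspForm →ₗ[ℂ] (UpperHalfPlane → ℂ) where
  toFun x := ⇑(x.1 1)
  map_add' x y := by rfl
  map_smul' c x := by rfl

/-- **D-EV (TREE-PROVABLE, size M).** The value-at-`1` map sends `ℂ[G]·u_{F₀}` ONTO the `ℂ`-span of the slashes `F₀ ∣[2] γ` (`γ ∈ Γ' = ι(O₀'¹)`):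
`(indRep (redHom γ) u)(1) = u(redHom γ) = ρ(γ) F₀|_{Γ̄} = F₀ ∣[2] γ⁻¹` (`indRep_apply`, `dockNonsplit_apply_of_witness`, `coverRep_apply`, `coe_coverSlash`),
and every `g ∈ GL₂(𝔽_q)` is `redHom γ · t` (`redHom_surjective_of_odd` + `det` surjective on `T_η`). -/
theorem map_coeEvOne_spanG_dockNonsplit (hq : q ∈ C) (R : CoverReduction X q) (hq2 : q ≠ 2) (F₀ : CuspForm X.Gamma 2) :
    Submodule.map (coeEvOne R) (R.spanG (R.dockNonsplit hq F₀)) =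
      Submodule.span ℂ (Set.range fun γ : coverUnits X q => (⇑F₀ : UpperHalfPlane → ℂ) ∣[(2 : ℤ)] ((γ : GL (Fin 2) ℝ))) := by
  sorry

/-- **D-AVG (TREE-PROVABLE, size S–M).** Unipotent averaging: if `G = w(1)` for some `w ∈ ℂ[G]·u_{F₀}` is non-zero and fixed under `∣[2] γ` by every
`γ ∈ Γ'` with `redHom γ` upper unipotent, then `Σ_y indRep(n(y)) w ∈ ℂ[G]·u_{F₀}` is non-zero (its value at `1` is `q·G`) and `N(𝔽_q)`-fixed. -/
theorem exists_unipFixed_of_slashFixed (hq : q ∈ C) (R : CoverReduction X q) (hq2 : q ≠ 2) (F₀ : CuspForm X.Gamma 2)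
    {G : UpperHalfPlane → ℂ}
    (hG : G ∈ Submodule.span ℂ (Set.range fun γ : coverUnits X q => (⇑F₀ : UpperHalfPlane → ℂ) ∣[(2 : ℤ)] ((γ : GL (Fin 2) ℝ))))
    (hG0 : G ≠ 0)
    (hfix : ∀ (γ : coverUnits X q) (y : ZMod q), R.redHom γ = upperUnip y → G ∣[(2 : ℤ)] ((γ : GL (Fin 2) ℝ)) = G) :
    ∃ x ∈ R.spanG (R.dockNonsplit hq F₀), x ≠ 0 ∧ ∀ y : ZMod q, R.indRep (upperUnip y) x = x := by
  sorry

/-- **GLUE (size S–M): (JVᴸ) ⟹ (JV_Q)** — instantiate (JVᴸ) at `hO' := isOrder_coverOrder X q`, `S := coverSubring X q` (`mem_coverSubring_iff`),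
`red := R.red` (`R.red_surjective`, `R.red_eq_zero_iff`, `R.det_red`), `F₀ := Q.form` (eigenvalues `a_ℓ(V)` from `Q.IsMinimalFor V` as in
`borelCubicEigenDocking_of_jacquet`), read `redHom γ = upperUnip y` as the three residue entries (`coe_redHom`, `coe_upperUnip`), then D-AVG.
Then (JV₇) = the stub by the PROVED `jacquetVectorResidual_of_docked`. -/
theorem jacquetVectorDocked_of_unipotentFixed (h : cartanCover_unipotentFixed_in_span) : JacquetVectorDocked' := by
  sorry

end ScritSketchDict

end
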